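import Mathlib.MeasureTheory.Measure.Prod
import Mathlib.Analysis.SpecialFunctions.Log.Basic
import Mathlib.Analysis.Calculus.Deriv.Basic
import Summits.CriticalPhenomena.CardyFormulaZ2.Theses.CardyFlipRusso
import Summits.CriticalPhenomena.CardyFormulaZ2.Theorems.CardyFlipRussoSquareFromVoronoiHubDefs
import Literature.Probability.Percolation.VoronoiCrossing
import Literature.Analysis.FunctionSpaces.PoissonPointProcess
import HarnessLib

/-!
# Sketch — crux idea `poissonised-chessboard` (crux stmt-CriticalPhenomena-6434
# `CardyFlipRusso.SquareFromVoronoiHub`, round 2, ideator 4)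

First lemmas of the card, typed over tree declarations only (no new axioms, no sorry):

* the Poissonised-chessboard leg `V_u`, `u ∈ [0,1]`: nuclei = free black / free white Poisson
  processes of intensity `(1-u)·volume` each (i.i.d. fair colours) superposed with BLOCK-type nuclei of
  intensity `2u·volume`, a block-type nucleus `x` carrying the fair coin `ε (blk m x)` of its block of the
  grid `m·ℤ²` (nucleus units);  `u = 0` is the crux hypothesis model verbatim (`PB ⊗ PW`, Lebesgue
  intensity each), `u = 1` is the "fair chessboard refined by a dense Poisson–Voronoi tessellation";
* `legProb` = the annealed probability of the Literature event `voronoiCrossing` for `V_u` at nucleus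
  scale `s`;  the schedule `mOf δ = max 1 |log δ|` blocks-per-side, `sOf δ = δ / mOf δ`;
* `LegConstancy` (the typed KERNEL in consumed/leg form for THIS leg; the single open stub),
  `ChessboardEndpoint` (u = 1 end ≡ site percolation on `G_s`, crude event; provable: whp coupling +
  slack), `HypothesisEnd` (u = 0 end is the hypothesis; provable now), the exact Mecke–Russo
  derivative `RussoMecke` (provable now from the tree's Mecke / perturbation formulas) with its
  summand `russoSummand` = `ε_{b(x)} · 1{x pivotal}`.
-/

noncomputable section

open MeasureTheory Metric Set Filter Topology
open Literature.Analysis.FunctionSpaces Literature.Probability.Percolation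
open Literature.Probability.RandomPlanarGeometry
open Summit.CriticalPhenomena.CardyFormulaZ2.Cruxes.SquareFromVoronoiHub.VoronoiBlocks

namespace Summit.CriticalPhenomena.CardyFormulaZ2.Cruxes.SquareFromVoronoiHub.PoissonisedChessboard

/-- Block index of a nucleus `x` (nucleus units) for blocks of side `m`. -/
def blk (m : ℝ) (x : ℂ) : ℤ × ℤ := (⌊x.re / m⌋, ⌊x.im / m⌋)

/-- A configuration of the leg: ((free black nuclei, free white nuclei), block-type nuclei), block coins
(`SiteConfig (ℤ × ℤ) = Set (ℤ × ℤ)`: the set of blocks whose coin is BLACK). -/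
abbrev LegConfig : Type := ((PointConfig ℂ × PointConfig ℂ) × PointConfig ℂ) × SiteConfig (ℤ × ℤ)

/-- Black nuclei of a leg configuration: free black ones and block-type ones lying in a black block. -/
def blackNuclei (m : ℝ) (ω : LegConfig) : Set ℂ :=
  (ω.1.1.1 : Set ℂ) ∪ {x | x ∈ (ω.1.2 : Set ℂ) ∧ blk m x ∈ ω.2}

/-- White nuclei of a leg configuration. -/
def whiteNuclei (m : ℝ) (ω : LegConfig) : Set ℂ :=
  (ω.1.1.2 : Set ℂ) ∪ {x | x ∈ (ω.1.2 : Set ℂ) ∧ blk m x ∉ ω.2}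

/-- The three nucleus laws of the leg at parameter `u`: free black / free white Poisson of intensity
`(1-u)·volume` each, block-type Poisson of intensity `2u·volume` (total intensity `2·volume` for every
`u`, as in the hypothesis `PB ⊗ PW`). -/
def IsLegLaw (u : ℝ) (PBf PWf PK : Measure (PointConfig ℂ)) : Prop :=
  IsPoissonPointProcess (ENNReal.ofReal (1 - u) • (volume : Measure ℂ)) PBf ∧
  IsPoissonPointProcess (ENNReal.ofReal (1 - u) • (volume : Measure ℂ)) PWf ∧
  IsPoissonPointProcess (ENNReal.ofReal (2 * u) • (volume : Measure ℂ)) PK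

/-- The annealed law of the leg: nuclei laws times fair block coins. -/
def legMeasure (PBf PWf PK : Measure (PointConfig ℂ)) : Measure LegConfig :=
  ((PBf.prod PWf).prod PK).prod (sitePercolation (ℤ × ℤ) half)

/-- The leg's crossing event of the conformal rectangle `R` at nucleus scale `s`, block side `m`. -/
def legCrossing (R : ConformalRectangle) (m s : ℝ) : Set LegConfig :=
  {ω | voronoiCrossing R.carrier (R.arc 0) (R.arc 2) s (blackNuclei m ω) (whiteNuclei m ω)}

/-- Annealed crossing probability of the leg. -/
def legProb (PBf PWf PK : Measure (PointConfig ℂ)) (R : ConformalRectangle) (m s : ℝ) : ℝ :=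
  (legMeasure PBf PWf PK).real (legCrossing R m s)

/-- Schedule: `mOf δ` nuclei per block side at lattice mesh `δ` (any `m² ≫ log(1/δ)` works for the
endpoint; `|log δ|` is a convenient overkill), `sOf δ` the nucleus scale. -/
def mOf (δ : ℝ) : ℝ := max 1 |Real.log δ|

/-- Nucleus scale at lattice mesh `δ`. -/
def sOf (δ : ℝ) : ℝ := δ / mOf δ

/-- **C⁺ = the kernel in leg form (OPEN; the single load-bearing stub).** Along the Poissonised-chessboard
leg the annealed crossing probabilities are asymptotically constant in `u`, uniformly on `[0,1]`:
for every conformal rectangle and `ε > 0`, eventually in `δ → 0⁺`, any two parameters `u, u'` (with any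
Poisson laws of the prescribed intensities) give crossing probabilities within `ε`. -/
def LegConstancy : Prop :=
  ∀ R : ConformalRectangle, ∀ ε > (0 : ℝ), ∀ᶠ δ in 𝓝[>] (0 : ℝ),
    ∀ u ∈ Icc (0 : ℝ) 1, ∀ u' ∈ Icc (0 : ℝ) 1,
    ∀ PBf PWf PK PBf' PWf' PK' : Measure (PointConfig ℂ),
      IsLegLaw u PBf PWf PK → IsLegLaw u' PBf' PWf' PK' →
        |legProb PBf PWf PK R (mOf δ) (sOf δ) - legProb PBf' PWf' PK' R (mOf δ) (sOf δ)| ≤ ε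

/-- **Endpoint (u = 1): the Poissonised chessboard IS site percolation on `G_s` in the limit** —
if the `u = 1` leg probabilities tend to `F(η)` then so do the crude `G_s` probabilities (whp coupling
"block connectivity through the continuum = ℤ² ⊕ i.i.d. fair corner diagonals ≡ `G_s`" for
`m² ≫ log(1/δ)`, plus slack robustness of the crude event).  Provable (new identity + boundary RSW). -/
def ChessboardEndpoint : Prop :=
  ∀ R : ConformalRectangle, ∀ PBf PWf PK : Measure (PointConfig ℂ), IsLegLaw 1 PBf PWf PK →
    R.HasCrossingLimit (fun δ => legProb PBf PWf PK R (mOf δ) (sOf δ)) cardyFunction →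
      R.HasCrossingLimit (siteCrossingProb R) cardyFunction

/-- **Hypothesis end (u = 0): the leg starts at the crux hypothesis** (block nuclei have intensity 0,
hence are a.s. absent; free nuclei are `PB ⊗ PW` of Lebesgue intensity; the rescaling `δ ↦ sOf δ` is a
reparametrisation of `δ → 0⁺`).  Provable now. -/
def HypothesisEnd : Prop :=
  (∀ (PB PW : Measure (PointConfig ℂ)),
      IsPoissonPointProcess (volume : Measure ℂ) PB → IsPoissonPointProcess (volume : Measure ℂ) PW →
      ∀ R : ConformalRectangle, R.HasCrossingLimit (voronoiCrossingProb PB PW R) cardyFunction) →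
  ∀ R : ConformalRectangle, ∀ PBf PWf PK : Measure (PointConfig ℂ), IsLegLaw 0 PBf PWf PK →
    R.HasCrossingLimit (fun δ => legProb PBf PWf PK R (mOf δ) (sOf δ)) cardyFunction

/-- A nucleus `x` is PIVOTAL for the crossing in configuration `ω`: recolouring it black gives a crossing,
recolouring it white gives none (`f(x→B) − f(x→W) = 1` for the increasing indicator `f`). -/
def IsPivotal (R : ConformalRectangle) (m s : ℝ) (ω : LegConfig) (x : ℂ) : Prop :=
  voronoiCrossing R.carrier (R.arc 0) (R.arc 2) s (insert x (blackNuclei m ω)) (whiteNuclei m ω \ {x}) ∧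
    ¬ voronoiCrossing R.carrier (R.arc 0) (R.arc 2) s (blackNuclei m ω \ {x}) (insert x (whiteNuclei m ω))

open Classical in
/-- The Mecke–Russo summand of the leg: `Σ_x ε_{b(x)} · 1{x pivotal}` over ALL nuclei `x` (free or
block-type), `ε_b = +1` for a black block coin, `−1` for a white one.  (A.s. only finitely many nuclei
are pivotal — their cells meet `closure Ω` — so the `finsum` is the honest sum.) -/
def russoSummand (R : ConformalRectangle) (m s : ℝ) (ω : LegConfig) : ℝ :=
  ∑ᶠ x ∈ ((ω.1.1.1 : Set ℂ) ∪ (ω.1.1.2 : Set ℂ) ∪ (ω.1.2 : Set ℂ)),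
    (if blk m x ∈ ω.2 then (1 : ℝ) else -1) * (if IsPivotal R m s ω x then (1 : ℝ) else 0)

/-- **Exact Mecke–Russo identity of the leg (provable now).** For a family of leg laws indexed by
`u ∈ [0,1]`, `u ↦ P_u[U]` is differentiable on `[0,1]` with derivative
`½ · E_u[Σ_x ε_{b(x)} 1{x pivotal}]`; in particular the derivative VANISHES at `u = 0` (no block-type
nucleus is present, so `ε_{b(x)}` is independent of everything else). -/
def RussoMecke : Prop :=
  ∀ (PBf PWf PK : ℝ → Measure (PointConfig ℂ)), (∀ u ∈ Icc (0 : ℝ) 1, IsLegLaw u (PBf u) (PWf u) (PK u)) →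
    ∀ R : ConformalRectangle, ∀ m s : ℝ, 0 < m → 0 < s → ∀ u ∈ Icc (0 : ℝ) 1,
      HasDerivWithinAt (fun v => legProb (PBf v) (PWf v) (PK v) R m s)
        ((1 / 2 : ℝ) * ∫ ω, russoSummand R m s ω ∂(legMeasure (PBf u) (PWf u) (PK u))) (Icc 0 1) u

/-- The card's transfer, as an implication to be glued (ε/2 argument + the two ends):
`HypothesisEnd ∧ LegConstancy ∧ ChessboardEndpoint ⇒ crux`.  Stated, not proved, at idea stage. -/
def TransferClaim : Prop :=
  HypothesisEnd → LegConstancy → ChessboardEndpoint →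
    Summit.CriticalPhenomena.CardyFormulaZ2.Theses.CardyFlipRusso.SquareFromVoronoiHub

/-- Sanity: the crux by name is "Cardy for `voronoiCrossingProb` → Cardy for `siteCrossingProb`"
(the tree's `squareFromVoronoiHub_iff`), i.e. exactly the antecedent of `HypothesisEnd` and the
consequent of `ChessboardEndpoint`. -/
example : Summit.CriticalPhenomena.CardyFormulaZ2.Theses.CardyFlipRusso.SquareFromVoronoiHub ↔
    ((∀ (PB PW : Measure (PointConfig ℂ)),
        IsPoissonPointProcess (volume : Measure ℂ) PB → IsPoissonPointProcess (volume : Measure ℂ) PW →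
        ∀ R : ConformalRectangle, R.HasCrossingLimit (voronoiCrossingProb PB PW R) cardyFunction) →
      ∀ R : ConformalRectangle, R.HasCrossingLimit (siteCrossingProb R) cardyFunction) :=
  squareFromVoronoiHub_iff

end Summit.CriticalPhenomena.CardyFormulaZ2.Cruxes.SquareFromVoronoiHub.PoissonisedChessboard

end
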